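import Mathlib
import Literature.Probability.LatticeModels.GKSInequalities
import Summits.CriticalPhenomena.Ising3DConformalLimit.Theorems.PrecisionLaplacianInverseMFerromagnetImLeFive
import Summits.CriticalPhenomena.Ising3DConformalLimit.Theorems.PrecisionLaplacianInverseMFerromagnetImOfImDeg3
import Summits.CriticalPhenomena.Ising3DConformalLimit.Theorems.PrecisionLaplacianInverseMFerromagnetWheelCore
import Summits.CriticalPhenomena.Ising3DConformalLimit.Theorems.PrecisionLaplacianInverseMFerromagnetWheelRingsum
import Summits.CriticalPhenomena.Ising3DConformalLimit.Theorems.PrecisionLaplacianInverseMFerromagnetWheelSl2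
import Summits.CriticalPhenomena.Ising3DConformalLimit.Theorems.PrecisionLaplacianInverseMFerromagnetWheelColumn
import HarnessLib

/-!
# Crux `PrecisionLaplacian.InverseMFerromagnet` (stmt-CriticalPhenomena-4798), line `Sketch` —
# Theorem W (IM for ALL WHEELS), part 2/2 (lead c6): the registered stub `helper_im_wheel`

THEOREM-ONLY file.  **Theorem W.** For every `n ≥ 3` and arbitrary positive rim couplings `K : Fin n → ℝ` and
spoke couplings `h : Fin n → ℝ`, every off-diagonal entry of the inverse spin second-moment matrix of the
zero-field Ising model on the wheel `W_n = C_n + hub` (sites `Fin (n+1)`, hub `Fin.last n`, bonds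
`Fin.append` (rim `{k,k+1}`) (spokes `{hub,k}`)) is `≤ 0` — the first infinite family of 3-connected graphs
(`K₄ = W₃`, treewidth 3) with arbitrary couplings for which the inverse-M conjecture of the crux is proved
(T-SP p122801 stops at treewidth 2, `helper_im_le_five` at five sites).
Proof (crux NOTES K6): `n ≤ 4` is `helper_im_le_five`.  For `n ≥ 5`: the apex reduction
`stub_wheel_ringsum` (wheel correlations = ring sums with nonnegative fields), the four-dimensional identity
`stub_wheel_sl2` (`𝒜⁻¹ = x₀I + x₋S₋ + x_cS + x₊S₊` for the rim monodromy, explicit positive coefficients) and the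
trace bookkeeping `stub_wheel_column` at base point `0`, transported to every base point `k` by rotating the ring
(`wglue_ringsum_rotate`, `wglue_column_at`; `x₀ = Tr 𝒜/(2 det 𝒜)` is base-point free by `wglue_trace_prod_add`,
`wglue_det_prod_comp_equiv`), give the hypotheses of the linear-algebra core `helper_wheel_core` (part 1).
-/

namespace Summit.CriticalPhenomena.Ising3DConformalLimit.Cruxes.InverseMFerromagnet.PartialCovarianceLadder

open Literature.Probability.LatticeModels Finset Matrix

noncomputable section

/-! ## Ring sums under rotation -/

/-- Rotating the couplings by `k` rotates the ring sums: for every observable `F`,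
`∑_x w_{K(·+k),h(·+k)}(x) F(x) = ∑_y w_{K,h}(y) F(y(·+k))`. [folklore] -/
theorem wglue_ringsum_rotate (m : ℕ) (K h : Fin (m + 1) → ℝ) (k : Fin (m + 1)) (F : (Fin (m + 1) → ℤˣ) → ℝ) :
    ∑ x : Fin (m + 1) → ℤˣ,
        Real.exp (∑ j : Fin (m + 1), (K (j + k) * (((x j : ℤ) : ℝ) * ((x (finRotate (m + 1) j) : ℤ) : ℝ))
          + h (j + k) * ((x j : ℤ) : ℝ))) * F x
      = ∑ y : Fin (m + 1) → ℤˣ,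
        Real.exp (∑ i : Fin (m + 1), (K i * (((y i : ℤ) : ℝ) * ((y (finRotate (m + 1) i) : ℤ) : ℝ))
          + h i * ((y i : ℤ) : ℝ))) * F (fun j => y (j + k)) := by
  -- substitute `y = x ∘ (· - k)` on the right
  let e : (Fin (m + 1) → ℤˣ) ≃ (Fin (m + 1) → ℤˣ) := Equiv.arrowCongr (Equiv.addRight k) (Equiv.refl ℤˣ)
  conv_rhs => rw [← e.sum_comp]
  refine Finset.sum_congr rfl fun x _ => ?_
  have he : ∀ i, (e x) i = x (i - k) := by
    intro i
    simp [e, Equiv.arrowCongr_apply, sub_eq_add_neg]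
  have h1 : ∀ j : Fin (m + 1), j + k - k = j := fun j => by abel
  have h2 : ∀ j : Fin (m + 1), j + k + 1 - k = j + 1 := fun j => by abel
  congr 1
  · congr 1
    symm
    rw [← Equiv.sum_comp (Equiv.addRight k)]
    refine Finset.sum_congr rfl fun j _ => ?_
    simp only [Equiv.coe_addRight, finRotate_apply, he, h1, h2]
  · congr 1
    funext j
    rw [he, h1]



/-! ## the column relation at an arbitrary base point -/

/-- Index identities on the ring `Fin (m+1)`. [folklore] -/
theorem wglue_idx (m : ℕ) (hm : 2 ≤ m) (k : Fin (m + 1)) :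
    (⟨0, by omega⟩ : Fin (m + 1)) + k = k ∧ (⟨1, by omega⟩ : Fin (m + 1)) + k = k + 1 ∧
      (⟨m + 1 - 1, by omega⟩ : Fin (m + 1)) + k = k - 1 := by
  refine ⟨?_, ?_, ?_⟩
  · have h0 : (⟨0, by omega⟩ : Fin (m + 1)) = 0 := rfl
    rw [h0, zero_add]
  · apply Fin.ext
    rw [Fin.val_add, Fin.val_add, Fin.val_one', Nat.mod_eq_of_lt (show 1 < m + 1 by omega), Fin.val_mk, add_comm]
  · have hl : (⟨m + 1 - 1, by omega⟩ : Fin (m + 1)) = Fin.last m := Fin.ext (by simp)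
    rw [hl, eq_sub_iff_add_eq, add_assoc, add_comm k 1, ← add_assoc, Fin.last_add_one, zero_add]

/-- **The column relation at base point `k`** (stub D transported by rotating the ring): with
`𝒜_k = T_kT_{k+1}⋯T_{k−1}` and any `Sp, Sm, x`'s as in stub D, the ORIGINAL ring sums satisfy the hub relation,
vanish on rim rows `i ≠ k`, and take the commutator value on row `k`. [folklore] -/
theorem wglue_column_at (m : ℕ) (hm : 2 ≤ m) (K h : Fin (m + 1) → ℝ) (hK : ∀ k, 0 < K k) (k : Fin (m + 1))
    (Sp Sm : Matrix ℤˣ ℤˣ ℝ) (x0 xm xc xp : ℝ)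
    (hSp : (Matrix.of fun a b : ℤˣ => Real.exp (h k * ((a : ℤ) : ℝ) + K k * (((a : ℤ) : ℝ) * ((b : ℤ) : ℝ))))
        * Matrix.diagonal (fun a : ℤˣ => ((a : ℤ) : ℝ))
      = Sp * Matrix.of fun a b : ℤˣ => Real.exp (h k * ((a : ℤ) : ℝ) + K k * (((a : ℤ) : ℝ) * ((b : ℤ) : ℝ))))
    (hSm : Matrix.diagonal (fun a : ℤˣ => ((a : ℤ) : ℝ))
        * (Matrix.of fun a b : ℤˣ => Real.exp (h (k - 1) * ((a : ℤ) : ℝ) + K (k - 1) * (((a : ℤ) : ℝ) * ((b : ℤ) : ℝ))))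
      = (Matrix.of fun a b : ℤˣ => Real.exp (h (k - 1) * ((a : ℤ) : ℝ) + K (k - 1) * (((a : ℤ) : ℝ) * ((b : ℤ) : ℝ))))
        * Sm)
    (hY : (x0 • (1 : Matrix ℤˣ ℤˣ ℝ) + xm • Sm + xc • Matrix.diagonal (fun a : ℤˣ => ((a : ℤ) : ℝ)) + xp • Sp)
        * (List.ofFn fun j : Fin (m + 1) => Matrix.of fun a b : ℤˣ =>
            Real.exp (h (j + k) * ((a : ℤ) : ℝ) + K (j + k) * (((a : ℤ) : ℝ) * ((b : ℤ) : ℝ)))).prod = 1) :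
    (x0 * (∑ x : Fin (m + 1) → ℤˣ, Real.exp (∑ i, (K i * (((x i : ℤ) : ℝ) * ((x (finRotate (m + 1) i) : ℤ) : ℝ))
          + h i * ((x i : ℤ) : ℝ))))
      + xm * (∑ x : Fin (m + 1) → ℤˣ, Real.exp (∑ i, (K i * (((x i : ℤ) : ℝ) * ((x (finRotate (m + 1) i) : ℤ) : ℝ))
          + h i * ((x i : ℤ) : ℝ))) * ((x (k - 1) : ℤ) : ℝ))
      + xc * (∑ x : Fin (m + 1) → ℤˣ, Real.exp (∑ i, (K i * (((x i : ℤ) : ℝ) * ((x (finRotate (m + 1) i) : ℤ) : ℝ))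
          + h i * ((x i : ℤ) : ℝ))) * ((x k : ℤ) : ℝ))
      + xp * (∑ x : Fin (m + 1) → ℤˣ, Real.exp (∑ i, (K i * (((x i : ℤ) : ℝ) * ((x (finRotate (m + 1) i) : ℤ) : ℝ))
          + h i * ((x i : ℤ) : ℝ))) * ((x (k + 1) : ℤ) : ℝ)) = 2) ∧
    (∀ i : Fin (m + 1), i ≠ k →
      x0 * (∑ x : Fin (m + 1) → ℤˣ, Real.exp (∑ i, (K i * (((x i : ℤ) : ℝ) * ((x (finRotate (m + 1) i) : ℤ) : ℝ))
          + h i * ((x i : ℤ) : ℝ))) * ((x i : ℤ) : ℝ))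
      + xm * (∑ x : Fin (m + 1) → ℤˣ, Real.exp (∑ i, (K i * (((x i : ℤ) : ℝ) * ((x (finRotate (m + 1) i) : ℤ) : ℝ))
          + h i * ((x i : ℤ) : ℝ))) * ((x i : ℤ) : ℝ) * ((x (k - 1) : ℤ) : ℝ))
      + xc * (∑ x : Fin (m + 1) → ℤˣ, Real.exp (∑ i, (K i * (((x i : ℤ) : ℝ) * ((x (finRotate (m + 1) i) : ℤ) : ℝ))
          + h i * ((x i : ℤ) : ℝ))) * ((x i : ℤ) : ℝ) * ((x k : ℤ) : ℝ))
      + xp * (∑ x : Fin (m + 1) → ℤˣ, Real.exp (∑ i, (K i * (((x i : ℤ) : ℝ) * ((x (finRotate (m + 1) i) : ℤ) : ℝ))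
          + h i * ((x i : ℤ) : ℝ))) * ((x i : ℤ) : ℝ) * ((x (k + 1) : ℤ) : ℝ)) = 0) ∧
    (x0 * (∑ x : Fin (m + 1) → ℤˣ, Real.exp (∑ i, (K i * (((x i : ℤ) : ℝ) * ((x (finRotate (m + 1) i) : ℤ) : ℝ))
          + h i * ((x i : ℤ) : ℝ))) * ((x k : ℤ) : ℝ))
      + xm * (∑ x : Fin (m + 1) → ℤˣ, Real.exp (∑ i, (K i * (((x i : ℤ) : ℝ) * ((x (finRotate (m + 1) i) : ℤ) : ℝ))
          + h i * ((x i : ℤ) : ℝ))) * ((x k : ℤ) : ℝ) * ((x (k - 1) : ℤ) : ℝ))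
      + xc * (∑ x : Fin (m + 1) → ℤˣ, Real.exp (∑ i, (K i * (((x i : ℤ) : ℝ) * ((x (finRotate (m + 1) i) : ℤ) : ℝ))
          + h i * ((x i : ℤ) : ℝ))) * ((x k : ℤ) : ℝ) * ((x k : ℤ) : ℝ))
      + xp * (∑ x : Fin (m + 1) → ℤˣ, Real.exp (∑ i, (K i * (((x i : ℤ) : ℝ) * ((x (finRotate (m + 1) i) : ℤ) : ℝ))
          + h i * ((x i : ℤ) : ℝ))) * ((x k : ℤ) : ℝ) * ((x (k + 1) : ℤ) : ℝ))
      = xp * Matrix.trace ((Matrix.diagonal (fun a : ℤˣ => ((a : ℤ) : ℝ)) * Sp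
          - Sp * Matrix.diagonal (fun a : ℤˣ => ((a : ℤ) : ℝ)))
          * (List.ofFn fun j : Fin (m + 1) => Matrix.of fun a b : ℤˣ =>
              Real.exp (h (j + k) * ((a : ℤ) : ℝ) + K (j + k) * (((a : ℤ) : ℝ) * ((b : ℤ) : ℝ)))).prod)) := by
  obtain ⟨hI0, hI1, hIl⟩ := wglue_idx m hm k
  have hD := stub_wheel_column (m + 1) (by omega) (fun j => K (j + k)) (fun j => h (j + k)) (fun j => hK _)
  beta_reduce at hD
  simp only [hI0, hIl] at hD
  obtain ⟨hR1, hR2, hR3⟩ := hD Sp Sm x0 xm xc xp hSp hSm hY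
  have hrot := wglue_ringsum_rotate m K h k
  have hZr := hrot (fun _ => (1 : ℝ))
  simp only [mul_one] at hZr
  have hml : m + 1 - 1 < m + 1 := by omega
  have h0l : 0 < m + 1 := by omega
  have h1l : 1 < m + 1 := by omega
  refine ⟨?_, ?_, ?_⟩
  · rw [hZr, hrot (fun x => ((x ⟨m + 1 - 1, hml⟩ : ℤ) : ℝ)), hrot (fun x => ((x ⟨0, h0l⟩ : ℤ) : ℝ)),
      hrot (fun x => ((x ⟨1, h1l⟩ : ℤ) : ℝ))] at hR1
    beta_reduce at hR1
    simp only [hI0, hI1, hIl] at hR1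
    exact hR1
  · intro i hi
    have hik : i - k ≠ ⟨0, h0l⟩ := sub_ne_zero.2 hi
    have h2 := hR2 (i - k) hik
    simp only [mul_assoc] at h2
    rw [hrot (fun x => ((x (i - k) : ℤ) : ℝ)), hrot (fun x => ((x (i - k) : ℤ) : ℝ) * ((x ⟨m + 1 - 1, hml⟩ : ℤ) : ℝ)),
      hrot (fun x => ((x (i - k) : ℤ) : ℝ) * ((x ⟨0, h0l⟩ : ℤ) : ℝ)),
      hrot (fun x => ((x (i - k) : ℤ) : ℝ) * ((x ⟨1, h1l⟩ : ℤ) : ℝ))] at h2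
    beta_reduce at h2
    simp only [hI0, hI1, hIl, sub_add_cancel] at h2
    simpa only [mul_assoc] using h2
  · simp only [mul_assoc] at hR3
    rw [hrot (fun x => ((x ⟨0, h0l⟩ : ℤ) : ℝ)), hrot (fun x => ((x ⟨0, h0l⟩ : ℤ) : ℝ) * ((x ⟨m + 1 - 1, hml⟩ : ℤ) : ℝ)),
      hrot (fun x => ((x ⟨0, h0l⟩ : ℤ) : ℝ) * ((x ⟨0, h0l⟩ : ℤ) : ℝ)),
      hrot (fun x => ((x ⟨0, h0l⟩ : ℤ) : ℝ) * ((x ⟨1, h1l⟩ : ℤ) : ℝ))] at hR3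
    beta_reduce at hR3
    simp only [hI0, hI1, hIl] at hR3
    simpa only [mul_assoc] using hR3

/-! ## the wheel theorem -/

/-- The bonds of the wheel have two endpoints each. [folklore] -/
theorem wglue_card_two (n : ℕ) (hn : 3 ≤ n) (i : Fin (n + n)) :
    (Fin.append (fun k : Fin n => ({k.castSucc, (finRotate n k).castSucc} : Finset (Fin (n + 1))))
      (fun k : Fin n => ({Fin.last n, k.castSucc} : Finset (Fin (n + 1)))) i).card = 2 := by
  obtain ⟨m, rfl⟩ : ∃ m, n = m + 1 := ⟨n - 1, by omega⟩
  refine Fin.addCases (fun k => ?_) (fun k => ?_) i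
  · rw [Fin.append_left, Finset.card_pair]
    intro hk
    have hk' := Fin.castSucc_injective _ hk
    rw [finRotate_apply] at hk'
    have h1 : (1 : Fin (m + 1)) = 0 := by
      have := congrArg (fun t => t - k) hk'
      simpa using this.symm
    have h2 := congrArg Fin.val h1
    rw [Fin.val_one', Fin.val_zero] at h2
    rw [Nat.mod_eq_of_lt (by omega)] at h2
    exact one_ne_zero h2
  · rw [Fin.append_right, Finset.card_pair]
    exact (ne_of_lt (Fin.castSucc_lt_last k)).symm

/-- **Theorem W (lead c6): the inverse-M property for every wheel.**  For `n ≥ 3` and arbitrary positive rim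
couplings `K` and spoke couplings `h`, every off-diagonal entry of the inverse spin second-moment matrix of the
zero-field Ising model on the wheel `W_n` is `≤ 0`.  Proof: `n ≤ 4` is `helper_im_le_five`; for `n ≥ 5` the
apex reduction (`stub_wheel_ringsum`), the four-dimensional identity (`stub_wheel_sl2`) and the trace bookkeeping
(`stub_wheel_column`, transported to every base point by rotating the ring) give, for each rim site `k`, the column
relation `N ζ_k = 2 e_hub + δ_k e_k` (`δ_k < 0`), hence `δ_k (N⁻¹ e_k) = ζ_k − 2 N⁻¹ e_hub`; all hub entries of `N⁻¹`
share the sign of `−(x₀ − 2 s)` and are therefore `≤ 0` (else `pᵀ B p = −s pᵀA < 0` contradicts `N ≻ 0`), and the rim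
entries follow. [folklore] -/
theorem helper_im_wheel :
    ∀ (n : ℕ), 3 ≤ n → ∀ (K h : Fin n → ℝ), (∀ k, 0 < K k) → (∀ k, 0 < h k) →
      ∀ x y : Fin (n + 1), x ≠ y →
        (Matrix.of fun p q : Fin (n + 1) =>
          gksExpect Finset.univ (Fin.append K h)
            (Fin.append (fun k : Fin n => ({k.castSucc, (finRotate n k).castSucc} : Finset (Fin (n + 1))))
              (fun k : Fin n => ({Fin.last n, k.castSucc} : Finset (Fin (n + 1)))))
            (fun ω => spinAt p ω * spinAt q ω))⁻¹ x y ≤ 0 := by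
  intro n hn K h hK hh x y hxy
  have hKw : ∀ i, 0 ≤ Fin.append K h i := by
    refine Fin.addCases (fun k => ?_) (fun k => ?_)
    · rw [Fin.append_left]; exact (hK k).le
    · rw [Fin.append_right]; exact (hh k).le
  rcases Nat.lt_or_ge 4 n with hn5 | hn4
  swap
  · exact helper_im_le_five (n + 1) (n + n) _ _ (by omega) hKw (wglue_card_two n hn) x y hxy
  -- `n ≥ 5`
  obtain ⟨m, rfl⟩ : ∃ m, n = m + 1 := ⟨n - 1, by omega⟩
  have hm2 : 2 ≤ m := by omega
  obtain ⟨hZ, hApos, hBB, hAl, hAr, hll⟩ := stub_wheel_ringsum (m + 1) hn K h (fun k => (hK k).le) hh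
  beta_reduce at hZ hApos hBB hAl hAr hll
  -- transfer matrices and the base-point monodromy
  let Tm : Fin (m + 1) → Matrix ℤˣ ℤˣ ℝ := fun j =>
    Matrix.of fun a b : ℤˣ => Real.exp (h j * ((a : ℤ) : ℝ) + K j * (((a : ℤ) : ℝ) * ((b : ℤ) : ℝ)))
  let X0 : ℝ := ((List.ofFn Tm).prod (-1) (-1) + (List.ofFn Tm).prod 1 1) / (2 * ((List.ofFn Tm).prod).det)
  refine helper_wheel_core m hm2 _ (c5_posDef _ _ _) _ _ _ hZ hApos hBB hAl hAr hll X0 (fun k => ?_) x y hxy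
  -- the monodromy at base point `k`
  have hpos : ∀ a b, 0 < (List.ofFn fun j : Fin (m + 1) => Tm (j + k)).prod a b :=
    wglue_prod_ofFn_pos _ (fun j a b => Real.exp_pos _) (by omega)
  have hdet : 0 < ((List.ofFn fun j : Fin (m + 1) => Tm (j + k)).prod).det := by
    rw [wglue_det_prod_ofFn]
    exact Finset.prod_pos fun j _ => wglue_det_transfer_pos _ _ (hK _)
  obtain ⟨hSp, hSm, hY, -, hxmp, -, hδneg⟩ :=
    stub_wheel_sl2 (K (k - 1)) (K k) (h k) (hK _) (hK _) (hh k).ne' _ hpos hdet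
  beta_reduce at hSp hSm hY hxmp hδneg
  obtain ⟨hxm, hxp⟩ := hxmp (hh k)
  obtain ⟨hR1, hR2, hR3⟩ := wglue_column_at m hm2 K h hK k _ _ _ _ _ _ hSp (hSm (h (k - 1))) hY
  -- the coefficient `x₀` does not depend on the base point
  have hdet0 : ((List.ofFn fun j : Fin (m + 1) => Tm (j + k)).prod).det = ((List.ofFn Tm).prod).det :=
    wglue_det_prod_comp_equiv Tm (Equiv.addRight k)
  have htr : ∀ M : Matrix ℤˣ ℤˣ ℝ, M.trace = M 1 1 + M (-1) (-1) := by
    intro M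
    have huniv : (Finset.univ : Finset ℤˣ) = {1, -1} := rfl
    rw [Matrix.trace, huniv, Finset.sum_pair (by decide)]
    rfl
  have htr0 : (List.ofFn fun j : Fin (m + 1) => Tm (j + k)).prod (-1) (-1)
      + (List.ofFn fun j : Fin (m + 1) => Tm (j + k)).prod 1 1
      = (List.ofFn Tm).prod (-1) (-1) + (List.ofFn Tm).prod 1 1 := by
    have h1 := wglue_trace_prod_add m Tm k
    rw [htr, htr] at h1
    linarith
  have hx0 : ((List.ofFn fun j : Fin (m + 1) => Tm (j + k)).prod (-1) (-1)
        / ((List.ofFn fun j : Fin (m + 1) => Tm (j + k)).prod).det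
      + (List.ofFn fun j : Fin (m + 1) => Tm (j + k)).prod 1 1
        / ((List.ofFn fun j : Fin (m + 1) => Tm (j + k)).prod).det) / 2 = X0 := by
    simp only [X0]
    rw [← htr0, hdet0]
    field_simp
  refine ⟨_, ?_, _, _, hδneg (hh k), hxm, hxp, ?_, ?_, ?_⟩
  rotate_left
  · rw [← hx0]; exact hR1
  · intro i hi; rw [← hx0]; exact hR2 i hi
  · rw [← hx0]; exact hR3

end

end Summit.CriticalPhenomena.Ising3DConformalLimit.Cruxes.InverseMFerromagnet.PartialCovarianceLadder
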